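import Mathlib.Algebra.Module.LinearMap.End
import Mathlib.Algebra.BigOperators.GroupWithZero.Action
import Mathlib.Algebra.BigOperators.Group.Finset.Defs
import Mathlib.Algebra.Group.Units.Hom
import Mathlib.Tactic.Module
import Mathlib.Tactic.Ring
import HarnessLib

/-!
# Kato 2004, Lemma 13.11 (1) from Lemma 13.10 (1) (pp. 230–231): the character-weighted sum of the
# four-term `(c, d)`-law collapses to a product of two binomials — proved as module algebra

K. Kato, *`p`-adic Hodge theory and values of zeta functions of modular forms*, Astérisque **295**
(2004) 117–290 [Kato2004Asterisque]. In §13.9–13.11 ("preliminaries for the proofs of Thm. 12.5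
and Thm. 12.6") Kato expresses the INTEGRAL `p`-adic zeta elements of `a(A)`-type through the
rational ones `𝐳_γ^{(p)}` (Lemma 13.10 (1), p. 230, verbatim):

"Let `1 ≤ j ≤ k − 1`, `a, A ∈ ℤ`, `A ≥ 1`, and `c, d` be integers such that
`(c, 6pA) = (d, 6pN) = 1`. Then
`(c,d 𝐳^{(p)}_{p^n}(f, k, j, a(A), prime(pA)))_{n≥1}
  = {∏_ℓ (1 − ā_ℓ ℓ^{−k} σ_ℓ^{−1} + ε̄(ℓ) ℓ^{−k−1} σ_ℓ^{−2})} ·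
    (c²d² 𝐳^{(p)}_{γ₁} − c^{k+1−j} d² σ_c 𝐳^{(p)}_{γ₂} − c² d^{j+1} ε(d) σ_d 𝐳^{(p)}_{γ₃}
      + c^{k+1−j} d^{j+1} ε(d) σ_{cd} 𝐳^{(p)}_{γ₄})`
where `ℓ` ranges over all prime numbers `≠ p` which divide `A`, and `γ₁ = δ(f, j, a(A))`,
`γ₂ = δ(f, j, ac(A))`, `γ₃ = δ(f, j, “a/d”(A))`, `γ₄ = δ(f, j, “ac/d”(A))`. Here `“a/d”` means any
integer `b` such that `bd ≡ a mod A`, and `“ac/d”` means any integer `b` such that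
`bd ≡ ac mod A`."

and then sums against a character (Lemma 13.11 (1), p. 231, verbatim):

"Let `A ≥ 1` and let `ν` be a homomorphism `(ℤ/A)^× → ℚ̄^×`. (1) For integers `c, d` such that
`(c, 6Ap) = (d, 6ANp) = 1`, we have
`Σ_{a∈(ℤ/A)^×} ν(a) · (c,d 𝐳^{(p)}_{p^n}(f, k, k − 1, a(A), prime(pA)))_{n≥1}
  = {∏_ℓ (1 − ā_ℓ ℓ^{−k} σ_ℓ^{−1} + ε̄(ℓ) ℓ^{−k−1} σ_ℓ^{−2})} ·
    (c² − c² ν(c)^{−1} σ_c)(d² − d^k ε(d) ν(d) σ_d) · Σ_{a∈(ℤ/A)^×} ν(a) 𝐳^{(p)}_{δ(f,k−1,a(A))}`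
in `𝐇¹(V_{F_λ}(f)) ⊗_Λ Q(Λ) ⊗_{O_λ} F̄_λ`, where `ℓ` ranges over all prime numbers `≠ p` which
divide `A`. … *Proof.* — (1) follows from Lemma 13.10 (1)."

The deduction "(1) follows from Lemma 13.10 (1)" is pure algebra: with `j = k − 1` the exponents in
13.10 (1) are `c^{k+1−j} = c²`, `d^{j+1} = d^k`; the map `a ↦ 𝐳^{(p)}_{δ(f,j,a(A))}` depends on
`a mod A` only (Cor. 5.10, p. 160), the four symbols are `a`, `ac`, `a d⁻¹`, `a c d⁻¹` in
`(ℤ/A)^×`, and re-indexing the sum over `(ℤ/A)^×` by `a ↦ ac`, `a ↦ a d⁻¹`, `a ↦ a c d⁻¹` produces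
the factors `ν(c)^{−1}`, `ν(d)`, `ν(c)^{−1}ν(d)`; `σ_{cd} = σ_c σ_d` and linearity of the common
Euler-factor operator do the rest.

## What is proved (theorems only; no definition, no named fact — D-0014/D-0026)

Over any commutative ring `R`, `R`-module `M` (Kato: `𝐇¹(V_{F_λ}(f)) ⊗_Λ Q(Λ) ⊗ F̄_λ` as a module
over `R = Λ ⊗ F̄_λ`-scalars), finite commutative index group `G` (Kato: `(ℤ/A)^×`), character
`ν : G →* Rˣ`, family `z : G → M` (`a ↦ 𝐳^{(p)}_{δ(f,j,a(A))}`), commuting-or-not endomorphisms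
`Sc, Sd : M →ₗ[R] M` (`σ_c`, `σ_d`; `σ_{cd}` enters as `Sc ∘ Sd`), an outer endomorphism `E`
(the Euler-factor product) and scalars `α, α', β, β' : R` (`c², c^{k+1−j}, d², d^{j+1}ε(d)`):

* `Kato2004.sum_character_smul_comp_mul` — the re-indexing step
  `Σ_a ν(a) • w(a g) = ν(g)⁻¹ • Σ_a ν(a) • w(a)`.
* `Kato2004.sum_character_fourTerm_eq_prod_apply` — **Lemma 13.11 (1) ⟸ Lemma 13.10 (1)**:
  `Σ_a ν(a) • E(αβ • z a − α'β • Sc (z (a c)) − αβ' • Sd (z (a d⁻¹)) + α'β' • Sc (Sd (z (a c d⁻¹))))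
   = E (((α − α' ν(c)⁻¹ • Sc) (β − β' ν(d) • Sd)) (Σ_a ν(a) • z a))`.

Specialisation used by the `(c, d)`-bookkeeping of any consumer of Kato's `a(A)`-type classes for an
elliptic curve (`k = 2`, `j = 1`, `ε = 1`): `α = α' = c²`, `β = β' = d²` at the `Λ`-adic
normalisation of 13.10/13.11, resp. `(u, v) = (1, 1)` at the finite-level normalisation of
Thm. 6.6 / (4.2.4) (p. 143: `(u, v) = (r + 2 − k, r)` if `r′ = k − 1`, `(k − r′, r′)` if `r = k − 1`).
Nothing here defines `𝐳^{(p)}`, `δ(f, j, a(A))` or `σ`; nothing is asserted about them.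

References: [Kato2004Asterisque] Lemma 13.10 (1) (p. 230), Lemma 13.11 (1) (p. 231), Cor. 5.10
(p. 160), (4.2.4) (p. 143); page images `HOME/b2b-bsdres-lit-kato/kato-pages/strips-gen14/`
(unit `b2b-bsdres-lit-kato` gen 14, KATO-PAGE-READ-gen14.md §1.8).
-/

namespace Literature.NumberTheory.EllipticCurves

namespace Kato2004

variable {R M G : Type*} [CommRing R] [AddCommGroup M] [Module R M] [CommGroup G] [Fintype G]

/-- **Re-indexing a character-weighted sum** (the step behind "13.11 (1) follows from 13.10 (1)",
p. 231): for a character `ν : G →* Rˣ` of a finite commutative group `G` (Kato: `(ℤ/A)^×`), a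
family `w : G → M` and `g ∈ G`,
`Σ_{a} ν(a) • w(a·g) = ν(g)⁻¹ • Σ_{a} ν(a) • w(a)` (substitute `b = a·g`, `ν(b g⁻¹) = ν(b)ν(g)⁻¹`).
[cite: Kato2004Asterisque, Lemma 13.11 (1), proof, p. 231] -/
theorem sum_character_smul_comp_mul (ν : G →* Rˣ) (w : G → M) (g : G) :
    ∑ a, (ν a : R) • w (a * g) = ((ν g)⁻¹ : Rˣ).val • ∑ a, (ν a : R) • w a := by
  rw [Finset.smul_sum]
  rw [← Equiv.sum_comp (Equiv.mulRight g) (fun b => ((ν g)⁻¹ : Rˣ).val • ((ν b : R) • w b))]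
  refine Finset.sum_congr rfl fun a _ => ?_
  simp only [Equiv.coe_mulRight, smul_smul, map_mul, Units.val_mul]
  congr 1
  calc (ν a : R) = ((ν g)⁻¹ : Rˣ).val * (ν g : R) * (ν a : R) := by
        rw [Units.inv_mul, one_mul]
    _ = ((ν g)⁻¹ : Rˣ).val * ((ν a : R) * (ν g : R)) := by ring

/-- The re-indexing step through an `R`-linear map `F` and with an extra scalar `s`:
`Σ_a ν(a) • (s • F(w(a·g))) = (s · ν(g)⁻¹) • F(Σ_a ν(a) • w(a))`.
[cite: Kato2004Asterisque, Lemma 13.11 (1), proof, p. 231] -/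
theorem sum_character_smul_smul_map_comp_mul {M' : Type*} [AddCommGroup M'] [Module R M']
    (F : M →ₗ[R] M') (ν : G →* Rˣ) (w : G → M) (s : R) (g : G) :
    ∑ a, (ν a : R) • (s • F (w (a * g))) = (s * ((ν g)⁻¹ : Rˣ).val) • F (∑ a, (ν a : R) • w a) := by
  have h := sum_character_smul_comp_mul ν (fun a => F (w a)) g
  simp_rw [smul_comm ((ν _ : Rˣ) : R) s]
  rw [← Finset.smul_sum, h, smul_smul, map_sum]
  simp_rw [map_smul]

/-- **Kato 2004, Lemma 13.11 (1) from Lemma 13.10 (1) (pp. 230–231), as module algebra.**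
Let `z : G → M` (`a ↦ 𝐳^{(p)}_{δ(f,j,a(A))}`, `G = (ℤ/A)^×`), `ν : G →* Rˣ` a character,
`Sc, Sd : M →ₗ[R] M` (`σ_c`, `σ_d`, so that `σ_{cd} = Sc ∘ Sd`), `E : M →ₗ[R] M` (the Euler-factor
operator `∏_ℓ (1 − ā_ℓ ℓ^{−k} σ_ℓ^{−1} + ε̄(ℓ) ℓ^{−k−1} σ_ℓ^{−2})`), and scalars `α, α', β, β'`
(`c², c^{k+1−j}, d², d^{j+1} ε(d)`). If the `a`-th integral class is the four-term expression of
Lemma 13.10 (1),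
`x_a = E(αβ • z(a) − α'β • Sc z(ac) − αβ' • Sd z(a d⁻¹) + α'β' • Sc Sd z(a c d⁻¹))`,
then
`Σ_a ν(a) • x_a = E((α − α'ν(c)⁻¹ Sc)(β − β'ν(d) Sd) · Σ_a ν(a) • z(a))`
— Kato's displayed 13.11 (1) (with `j = k − 1`: `α' = c²`, `β' = d^k ε(d)`).
[cite: Kato2004Asterisque, Lemma 13.11 (1) (p. 231), Lemma 13.10 (1) (p. 230)] -/
theorem sum_character_fourTerm_eq_prod_apply (E Sc Sd : Module.End R M) (ν : G →* Rˣ)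
    (z : G → M) (c d : G) (α α' β β' : R) :
    ∑ a, (ν a : R) • E ((α * β) • z a - (α' * β) • Sc (z (a * c)) - (α * β') • Sd (z (a * d⁻¹))
        + (α' * β') • Sc (Sd (z (a * (c * d⁻¹)))))
      = E (((α • (1 : Module.End R M) - (α' * ((ν c)⁻¹ : Rˣ).val) • Sc) *
            (β • (1 : Module.End R M) - (β' * (ν d : R)) • Sd)) (∑ a, (ν a : R) • z a)) := by
  -- pull the outer operator `E` out of the sum
  simp_rw [← map_smul E]
  rw [← map_sum]
  congr 1
  -- the four character-weighted sums, re-indexed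
  have h1 : ∑ a, (ν a : R) • ((α * β) • z a) = (α * β) • ∑ a, (ν a : R) • z a := by
    simp_rw [smul_comm ((ν _ : Rˣ) : R) (α * β)]
    rw [← Finset.smul_sum]
  have h2 := sum_character_smul_smul_map_comp_mul Sc ν z (α' * β) c
  have h3 := sum_character_smul_smul_map_comp_mul Sd ν z (α * β') d⁻¹
  rw [map_inv, inv_inv] at h3
  have h4 := sum_character_smul_smul_map_comp_mul (Sc ∘ₗ Sd) ν z (α' * β') (c * d⁻¹)
  simp only [LinearMap.coe_comp, Function.comp_apply, map_mul, map_inv, mul_inv, inv_inv,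
    Units.val_mul] at h4
  -- distribute the character over the four terms and substitute
  simp only [smul_add, smul_sub, Finset.sum_add_distrib, Finset.sum_sub_distrib]
  rw [h1, h2, h3, h4]
  -- expand the product of the two binomials
  simp only [Module.End.mul_apply, LinearMap.sub_apply, LinearMap.smul_apply,
    Module.End.one_apply, map_sub, map_smul]
  module

/-- **Scalar form (no Galois operators): the finite-level four-term law of Thm. 6.6 (1) summed
against a character.** With `Sc = Sd = E = 1` the previous theorem reads
`Σ_a ν(a) • (αβ • z(a) − α'β • z(ac) − αβ' • z(a d⁻¹) + α'β' • z(a c d⁻¹))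
  = ((α − α'ν(c)⁻¹)(β − β'ν(d))) • Σ_a ν(a) • z(a)`;
for Thm. 6.6 (1) (p. 163, `ξ = a(A)`, reading its fourth symbol as `“ac/d”(A)` with Thm. 5.6 (2)
p. 157 and Lemma 13.10 (1) p. 230): `α = c²`, `α' = c^u χ̄(c)`, `β = d²`, `β' = d^v χ̄(d) ε(d)`,
`z(a) = δ(f, r′, a(A))`, `(u, v)` as in (4.2.4) p. 143.
[cite: Kato2004Asterisque, Thm. 6.6 (1) (p. 163), Lemma 13.11 (1) (p. 231)] -/
theorem sum_character_fourTerm_eq_mul_smul (ν : G →* Rˣ) (z : G → M) (c d : G)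
    (α α' β β' : R) :
    ∑ a, (ν a : R) • ((α * β) • z a - (α' * β) • z (a * c) - (α * β') • z (a * d⁻¹)
        + (α' * β') • z (a * (c * d⁻¹)))
      = ((α - α' * ((ν c)⁻¹ : Rˣ).val) * (β - β' * (ν d : R))) • ∑ a, (ν a : R) • z a := by
  have h := sum_character_fourTerm_eq_prod_apply 1 1 1 ν z c d α α' β β'
  simp only [Module.End.one_apply, Module.End.mul_apply, LinearMap.sub_apply,
    LinearMap.smul_apply] at h
  rw [h]
  module

end Kato2004

end Literature.NumberTheory.EllipticCurves
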